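import Summits.BirchSwinnertonDyer.BirchSwinnertonDyer.Theorems.ByReductionTypeAtTwoOrdKatoHalfAtTwoIsoOrdKernelOfPoitouTate
import Summits.BirchSwinnertonDyer.BirchSwinnertonDyer.Theorems.TwoAdicConverseEulerCharKernelAtTwo
import Literature.NumberTheory.EllipticCurves.ModularCurvePeriodRatioTwoProofs
import HarnessLib

/-!
# Route ByReductionTypeAtTwo, crux `OrdKatoHalfAtTwoIso` (stmt-BirchSwinnertonDyer-19573), line `steinberg-fibre-at-two`,
# F1 slot (child stmt-BirchSwinnertonDyer-24097): GREENBERG'S THEOREM 4.1 (parity-free, conjunct 4 of `OrdPublishedInputsAtTwo`)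
# LEAVES THE F1 PRICE SHEET — the child `iff` re-keyed to {modularity, GZK, Kato 17.4 (1)(2) at 2} on the onto cells

Seat `cruxlead-stmt-BirchSwinnertonDyer-19573-w3` GEN 11 (prover WIDTH; LEAD lineage SUMMON-only; HOME `run/shared/lean/pub/bsd-2adic/`;
`--supports` stmt-BirchSwinnertonDyer-24097).  THEOREMS ONLY (no definition, no named fact, no `sorry`, no instance).  HONEST FRAMING (cell
bsd-2adic): BSD is not proved by any of this; nothing is closed; the research content of the F1 slot (G11⁺, G11⁻, N2D⁻ / MU13⁻) is untouched;
every theorem below is CONDITIONAL on the named facts and memo texts displayed in its signature.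

EVENT (conv-1 GEN 37, p746463 `TwoAdicConverseEulerCharKernelAtTwo`, 2026-08-29T21:42Z): Greenberg, LNM 1716, Thm. 4.1 AT `p = 2` in its
per-curve display `X5.O1.TwoAdicEulerCharRankZero W 0` is a KERNEL THEOREM for every `W/ℚ` with `E[2]` irreducible
(`TwoAdicEulerCharKernel.twoAdicEulerCharRankZero_of_hasIrreducibleModPGaloisRep_two`; tower-1 p742465 `…twoAdicEulerCharRankZero_of_T1` with
(T₁)@2 vacuous when `2 ∤ #E(ℚ)_tors`) — no printed fact read.

WHY THIS FILE.  The F1 doors of the line (w3 g5–g10, LEAD g6/g10) display the print bundle `hPub : OrdPublishedInputsAtTwo` = modularity ∧ GZK ∧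
Kato 17.4 (1)(2)@2 ∧ `Greenberg1999.thm41_charValue_rankZero_anyPrime` (Greenberg 4.1 parity-free at every `p`, audit flag
`Gre99-Thm41-at-2-archimedean`).  Reading every destructuring of `hPub` in the `…OrdKatoHalfAtTwoIso*` files: conjunct 4 is consumed at ONE
place only — `IsogenyMuShift.katoHalf_isogenyInvariant` (ord-3), feeding `O1.TwoAdicEulerCharRankZero · 0` at `W` AND at the isogenous member `W′`
of `OrdKatoHalfAtTwoIsoPosDisc` / of the crux, inside the NECESSITY doors (`mainConjectureLowerDivisibilityAtTwoOrd_of_posDisc`, `mu_eq_zero_of_posDisc`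
⟹ `greenbergMuZeroTwoOrdPosDisc_of_posDisc`; `greenbergMuZeroTwoOrdNegDisc_habitat_of_ordKatoHalfAtTwoIso`); every other door uses modularity
and/or Kato 17.4 only.  On the onto cells `E[2]` is irreducible at `W` (`hasIrreducibleModPGaloisRep_of_hasSurjectiveModNGaloisRep`) and at
every isogenous `W′` (`hasIrreducibleModPGaloisRep_of_isIsogenous`, Literature), so the kernel theorem supplies both Euler characteristics.
This file records the re-keyed doors («print3» := the first THREE conjuncts of `OrdPublishedInputsAtTwo`, displayed separately as
`hmod : nonempty_modularParametrizationData`, `hGZK : rank_eq_analyticRank_of_analyticRank_le_one`, `h17 : ∀ V f, kato_divisibility_allPrimes V 2`):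

* §1 `katoHalf_isogenyInvariant_of_irr (hmod) (hGZK) (h17) (hCassels)` (+ `_of_surj`) — the Kato–Néron half transports along a `ℚ`-isogeny on
  the rank-`0` good-ordinary domain for `E[2]`-IRREDUCIBLE `W`, Greenberg 4.1 NOT an input.
* §2 the `0 < Δ` necessity re-keyed: `mainConjectureLowerDivisibilityAtTwoOrd_of_posDisc_of_print3`, `mu_eq_zero_of_posDisc_of_print3`,
  `greenbergMuZeroTwoOrdPosDisc_of_posDisc_of_print3`, **`posDisc_iff_greenbergMu_of_print3`** (conjunct 2 ⟺ G11⁺ modulo {hmod, hGZK, h17, Cassels, AU}).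
* §3 SIGN-FREE necessity from the crux: **`greenbergMu_two_onto_habitat_of_ordKatoHalfAtTwoIso_of_print3`** — crux 202 ⟹ Greenberg `μ = 0` at `2`
  on the WHOLE onto habitat (non-CM, `r_an = 0`, good ordinary, `ρ̄₂` onto; both signs of `Δ`) modulo {hmod, hGZK, h17, Cassels, AU} — the LEAD's
  display `greenbergMu_two_onto_necessary` (skeleton v24 §4) WITHOUT Greenberg 4.1.
* §4 the `Δ < 0` doors (any rank) re-keyed to {hmod, h17}: `moduleFinite_selmerDual_of_greenbergMuNeg_of_print`, `muFreeValue_negDisc_of_greenbergMuNeg_of_zetaQuotientMu_of_print`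
  (G11⁻ + MU13⁻ ⟹ V♭⁻ verbatim), `zetaColemanMuIotaNegDiscAtTwo_of_greenbergMuNeg_of_{zetaQuotientMu,notTwoDivisible}_of_print` (⟹ F1μι⁻ with `hOK` FED
  from hPT + hQ, w3 g10), and the print-light necessity `zetaNotTwoDivisible_of_iotaNegDisc_of_modularity`, `greenbergMuNeg_of_iotaNegDisc_of_modularity`,
  `iotaNegDisc_iff_greenbergMuNeg_and_notTwoDivisible_of_print3`.
* §5 **`ordKatoFineZetaAtTwoResidue_iff_greenbergMu_both_and_notTwoDivisible_of_print3 (hPT) (hQ) (h12) (hmod) (hGZK) (h17) (hCassels) (hAU)`** —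
  child 24097 ⟺ G11⁺ ∧ G11⁻ ∧ N2D⁻, kernel `iff` with binder set {Poitou–Tate exactness p729889, the structure fact p740652, `thm12_4`, modularity,
  GZK, Kato 17.4 (1)(2)@2, Cassels, Abbes–Ullmo}: w3 g10's `…_of_structureFact` with Greenberg 4.1 GONE; the (⟸) halves BY NAME in both currencies
  (the MU13⁻ one `h12`-free AND `hGZK`/Cassels-free); the (⟹) half keyed by {hmod, hGZK, h17, Cassels, AU}.  (w3 g10's bundle-keyed `iff`
  `…_of_structureFact` is literally `…_of_print3 hPT hQ h12 hPub.1 hPub.2.1 (fun V _ _ _ f => hPub.2.2.1 V f) hCassels hAU` — conjunct 4 never projected.)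
RESIDUAL HABITAT of Greenberg 4.1@2 inside crux 202 (word for the LEAD / pen, not executed here): the NOT-onto cell B7′ (child 23921) at
`E[2]`-REDUCIBLE members failing (T₁)@2 (tower-1 GEN 36 census: the non-optimal members), where `katoHalf_isogenyInvariant` moves the half from the
lattice-optimal member; on `C₃`-image curves (irreducible, not onto) §1 applies verbatim.

References: [GreenbergLNM1716] Thm. 4.1 (p. 102), Conj. 1.11 (p. 64), §1 p. 64; [Kato2004Asterisque] Thm. 12.4 (p. 221), Thm. 12.6 (p. 222),
Thm. 17.4 (1)(2) (p. 273), Prop. 17.11 (p. 277), §17.13 (pp. 279–280); [AbbesUllmo1996] Thm. A; [MilneADT2006] I Thm. 4.10, I.7.3 (Cassels);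
[GreenbergVatsal2000] §3 Rem. 3.4; [Mazur1977] III §5; tree p742465, p746463 (conv-1 GEN 37), ord-3 `…OrdIsogenyTransport`, p741745, p746128, p746366.
-/

set_option autoImplicit false
set_option linter.dupNamespace false

noncomputable section

open scoped Classical MatrixGroups ModularForm NumberField
open CongruenceSubgroup WeierstrassCurve Field IsDedekindDomain NumberField
open Literature.NumberTheory.GaloisRepresentations
open Literature.NumberTheory.GaloisCohomology
open Literature.NumberTheory.EllipticCurves Literature.NumberTheory.EllipticCurves.ModularForms
  Literature.NumberTheory.EllipticCurves.GreenbergSelmer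
open Literature.NumberTheory.EllipticCurves.Kato2004
  Literature.NumberTheory.EllipticCurves.Kato2004.EulerSystemValues
open Literature.NumberTheory.EllipticCurves.IwasawaDual
open Literature.NumberTheory.EllipticCurves.Rank1Residual
open Literature.NumberTheory.EllipticCurves.Greenberg1999
open Summit.BirchSwinnertonDyer.Rank1Residual Summit.BirchSwinnertonDyer.Rank1Residual.X5
open Summit.BirchSwinnertonDyer.BirchSwinnertonDyer.Theses.ByReductionTypeAtTwo
open Summit.BirchSwinnertonDyer.BirchSwinnertonDyer.Theorems.TwoAdicEulerCharKernel

namespace Summit.BirchSwinnertonDyer.BirchSwinnertonDyer.Theorems.SteinbergFibreAtTwo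

/-! ## §1 The Kato–Néron half transports along isogenies WITHOUT Greenberg 4.1 on the `E[2]`-irreducible locus -/

/-- **THE KATO–NÉRON HALF IS AN ISOGENY-CLASS STATEMENT on the rank-`0` good-ordinary-at-`2` domain for `E[2]`-IRREDUCIBLE curves, keyed by
{modularity, GZK, Kato 17.4 (1)(2)@2, Cassels} — Greenberg's Thm. 4.1 NOT an input**: ord-3's `IsogenyMuShift.mainConjectureLowerDivisibilityAtTwoOrd_of_isIsogenous`
with both `2`-adic Euler characteristics `X5.O1.TwoAdicEulerCharRankZero · 0` (at `W`, at `W′`) KERNEL for `E[2]` irreducible (conv-1 GEN 37), irreducibility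
passing along the isogeny (`hasIrreducibleModPGaloisRep_of_isIsogenous`); conductor equality = Ogg–Saito (good at `2`).  CONDITIONAL; nothing closed.
[cite: Kato2004Asterisque, Thm. 17.4 (1)(2) (p. 273)] [cite: GreenbergLNM1716, Thm. 4.1 (p. 102); §1 p. 64] [cite: MilneADT2006, Thm. I.7.3 (Cassels)]
[cite: GreenbergVatsal2000, §3, Remark 3.4] -/
theorem katoHalf_isogenyInvariant_of_irr (hmod : nonempty_modularParametrizationData)
    (hGZK : rank_eq_analyticRank_of_analyticRank_le_one)
    (h17 : ∀ (V : WeierstrassCurve ℚ) [V.IsElliptic] [V.IsGloballyMinimal] [NeZero (V.conductorNorm ℤ)]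
      (f : CuspForm (Gamma0 (V.conductorNorm ℤ)) 2), kato_divisibility_allPrimes V 2 (f := f))
    (hCassels : bsdRHS_eq_of_isIsogenous) {W W' : WeierstrassCurve ℚ} [W.IsElliptic] [W'.IsElliptic]
    [W.IsGloballyMinimal] [W'.IsGloballyMinimal] (hiso : IsIsogenous W W') (hgo : GoodOrd W 2)
    (hirr : W.HasIrreducibleModPGaloisRep 2) (hr : W.analyticRank = 0) (hK' : O1.MainConjectureLowerDivisibilityAtTwoOrd W') :
    O1.MainConjectureLowerDivisibilityAtTwoOrd W :=
  IsogenyMuShift.mainConjectureLowerDivisibilityAtTwoOrd_of_isIsogenous hCassels hmod hGZK hiso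
    (IsogenyMuShift.conductorNorm_eq_of_isIsogenous_of_hasGoodReductionAtPrime_two hiso hgo.1) (fun f ↦ h17 W f)
    (twoAdicEulerCharRankZero_of_hasIrreducibleModPGaloisRep_two W hirr)
    (twoAdicEulerCharRankZero_of_hasIrreducibleModPGaloisRep_two W' (hasIrreducibleModPGaloisRep_of_isIsogenous hiso hirr))
    hr hK'

/-- **The same on the onto locus** (`ρ̄_{W,2}` onto ⟹ `E[2]` irreducible, Serre §4 / Dokchitser–Dokchitser): the form the F1 doors consume.
[cite: Kato2004Asterisque, Thm. 17.4 (1)(2) (p. 273)] [cite: MilneADT2006, Thm. I.7.3 (Cassels)] [cite: Serre1972, §4] -/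
theorem katoHalf_isogenyInvariant_of_surj (hmod : nonempty_modularParametrizationData)
    (hGZK : rank_eq_analyticRank_of_analyticRank_le_one)
    (h17 : ∀ (V : WeierstrassCurve ℚ) [V.IsElliptic] [V.IsGloballyMinimal] [NeZero (V.conductorNorm ℤ)]
      (f : CuspForm (Gamma0 (V.conductorNorm ℤ)) 2), kato_divisibility_allPrimes V 2 (f := f))
    (hCassels : bsdRHS_eq_of_isIsogenous) {W W' : WeierstrassCurve ℚ} [W.IsElliptic] [W'.IsElliptic]
    [W.IsGloballyMinimal] [W'.IsGloballyMinimal] (hiso : IsIsogenous W W') (hgo : GoodOrd W 2)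
    (h2 : W.HasSurjectiveModNGaloisRep 2) (hr : W.analyticRank = 0) (hK' : O1.MainConjectureLowerDivisibilityAtTwoOrd W') :
    O1.MainConjectureLowerDivisibilityAtTwoOrd W :=
  haveI : NeZero ((2 : ℕ) : ℚ) := ⟨by norm_num⟩
  katoHalf_isogenyInvariant_of_irr hmod hGZK h17 hCassels hiso hgo
    (hasIrreducibleModPGaloisRep_of_hasSurjectiveModNGaloisRep W 2 h2) hr hK'

/-! ## §2 The `0 < Δ` conjunct: NECESSITY re-keyed to print3 — conjunct 2 ⟺ G11⁺ without Greenberg 4.1 -/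

/-- **The `0 < Δ` conjunct gives the Kato–Néron half AT EVERY curve of the cell**, keyed by {hmod, hGZK, h17, Cassels} (LEAD g6's
`mainConjectureLowerDivisibilityAtTwoOrd_of_posDisc` with `katoHalf_isogenyInvariant` replaced by §1).  CONDITIONAL; nothing closed.
[cite: Kato2004Asterisque, Thm. 17.4 (1)(2) (p. 273)] [cite: MilneADT2006, Thm. I.7.3 (Cassels)] -/
theorem mainConjectureLowerDivisibilityAtTwoOrd_of_posDisc_of_print3 (hPos : OrdKatoHalfAtTwoIsoPosDisc)
    (hmod : nonempty_modularParametrizationData) (hGZK : rank_eq_analyticRank_of_analyticRank_le_one)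
    (h17 : ∀ (V : WeierstrassCurve ℚ) [V.IsElliptic] [V.IsGloballyMinimal] [NeZero (V.conductorNorm ℤ)]
      (f : CuspForm (Gamma0 (V.conductorNorm ℤ)) 2), kato_divisibility_allPrimes V 2 (f := f))
    (hCassels : bsdRHS_eq_of_isIsogenous) (W : WeierstrassCurve ℚ) [W.IsElliptic] [W.IsGloballyMinimal] (hcm : ¬ W.HasCM)
    (hr : W.analyticRank = 0) (hgo : GoodOrd W 2) (h2 : W.HasSurjectiveModNGaloisRep 2) (hΔ : 0 < W.Δ) :
    O1.MainConjectureLowerDivisibilityAtTwoOrd W := by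
  obtain ⟨W', _, _, hiso, hK'⟩ := hPos W hcm hr hgo h2 hΔ
  exact katoHalf_isogenyInvariant_of_surj hmod hGZK h17 hCassels hiso hgo h2 hr hK'

/-- **NECESSITY I re-keyed — the `0 < Δ` conjunct forces `μ(X(W/ℚ_∞)) = 0` at every curve of the cell and every normalised cyclotomic dual datum**,
granted {hmod, hGZK, h17, Cassels, Abbes–Ullmo} BY NAME (LEAD g6's `mu_eq_zero_of_posDisc`, Greenberg 4.1 NOT an input).  CONDITIONAL; nothing closed.
[cite: Kato2004Asterisque, Thm. 17.4 (1)(2) (p. 273)] [cite: AbbesUllmo1996, Thm. A] [cite: GreenbergLNM1716, Conj. 1.11 (p. 64)] -/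
theorem mu_eq_zero_of_posDisc_of_print3 (hPos : OrdKatoHalfAtTwoIsoPosDisc)
    (hmod : nonempty_modularParametrizationData) (hGZK : rank_eq_analyticRank_of_analyticRank_le_one)
    (h17 : ∀ (V : WeierstrassCurve ℚ) [V.IsElliptic] [V.IsGloballyMinimal] [NeZero (V.conductorNorm ℤ)]
      (f : CuspForm (Gamma0 (V.conductorNorm ℤ)) 2), kato_divisibility_allPrimes V 2 (f := f))
    (hCassels : bsdRHS_eq_of_isIsogenous) (hAU : abbesUllmo_not_dvd_maninConstant_of_not_dvd_level)
    (W : WeierstrassCurve ℚ) [W.IsElliptic] [W.IsGloballyMinimal] (hcm : ¬ W.HasCM) (hr : W.analyticRank = 0)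
    (hgo : GoodOrd W 2) (h2 : W.HasSurjectiveModNGaloisRep 2) (hΔ : 0 < W.Δ)
    {κ : ZpExtension ℚ 2} {γ : absoluteGaloisGroup ℚ} (hκ : κ.IsCyclotomic) (hγ : κ.IsTopGenerator γ)
    (hγ' : IsCyclotomicVariable 2 γ) (D : W.SelmerDualData κ γ) : D.mu = 0 :=
  haveI : NeZero ((2 : ℕ) : ℚ) := ⟨by norm_num⟩
  mu_eq_zero_of_katoMuPartAtTwo_of_irr W hAU hmod hgo (hasIrreducibleModPGaloisRep_of_hasSurjectiveModNGaloisRep W 2 h2)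
    (O1.katoMuPartAtTwo_of_mainConjectureLowerDivisibilityAtTwoOrd W (fun f ↦ h17 W f)
      (mainConjectureLowerDivisibilityAtTwoOrd_of_posDisc_of_print3 hPos hmod hGZK h17 hCassels W hcm hr hgo h2 hΔ))
    hκ hγ hγ' D

/-- **The `0 < Δ` conjunct + print3 + Cassels + Abbes–Ullmo ⟹ G11⁺** (w3 g6's `greenbergMuZeroTwoOrdPosDisc_of_posDisc`, Greenberg 4.1 dropped).
CONDITIONAL; nothing closed. [cite: GreenbergLNM1716, Conj. 1.11 (p. 64)] [cite: Kato2004Asterisque, Thm. 17.4 (1)(2) (p. 273)] [cite: AbbesUllmo1996, Thm. A] -/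
theorem greenbergMuZeroTwoOrdPosDisc_of_posDisc_of_print3 (hPos : OrdKatoHalfAtTwoIsoPosDisc)
    (hmod : nonempty_modularParametrizationData) (hGZK : rank_eq_analyticRank_of_analyticRank_le_one)
    (h17 : ∀ (V : WeierstrassCurve ℚ) [V.IsElliptic] [V.IsGloballyMinimal] [NeZero (V.conductorNorm ℤ)]
      (f : CuspForm (Gamma0 (V.conductorNorm ℤ)) 2), kato_divisibility_allPrimes V 2 (f := f))
    (hCassels : bsdRHS_eq_of_isIsogenous) (hAU : abbesUllmo_not_dvd_maninConstant_of_not_dvd_level) :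
    GreenbergMuZeroTwoOrdPosDisc :=
  fun W _ _ hcm hr hgo h2 hΔ _ _ hκ hγ hγ' D =>
    mu_eq_zero_of_posDisc_of_print3 hPos hmod hGZK h17 hCassels hAU W hcm hr hgo h2 hΔ hκ hγ hγ' D

/-- **The `0 < Δ` conjunct ⟺ G11⁺, kernel `iff` modulo {modularity, GZK, Kato 17.4 (1)(2)@2, Cassels, Abbes–Ullmo}** — the LEAD g10's
`posDisc_iff_greenbergMu_two` / w3 g6's merge with Greenberg 4.1 OFF the binder list: (⟹) above; (⟸) w3 g6's `ordKatoHalfAtTwoIsoPosDisc_of_greenbergMuZero`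
(`W′ := W`, Abbes–Ullmo + Kato 17.4 only).  Neither side is proved; nothing asserted.
[cite: GreenbergLNM1716, Conj. 1.11 (p. 64)] [cite: Kato2004Asterisque, Thm. 17.4 (1)(2) (p. 273)] [cite: AbbesUllmo1996, Thm. A] [cite: MilneADT2006, Thm. I.7.3 (Cassels)] -/
theorem posDisc_iff_greenbergMu_of_print3 (hmod : nonempty_modularParametrizationData)
    (hGZK : rank_eq_analyticRank_of_analyticRank_le_one)
    (h17 : ∀ (V : WeierstrassCurve ℚ) [V.IsElliptic] [V.IsGloballyMinimal] [NeZero (V.conductorNorm ℤ)]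
      (f : CuspForm (Gamma0 (V.conductorNorm ℤ)) 2), kato_divisibility_allPrimes V 2 (f := f))
    (hCassels : bsdRHS_eq_of_isIsogenous) (hAU : abbesUllmo_not_dvd_maninConstant_of_not_dvd_level) :
    OrdKatoHalfAtTwoIsoPosDisc ↔ GreenbergMuZeroTwoOrdPosDisc :=
  ⟨fun hPos => greenbergMuZeroTwoOrdPosDisc_of_posDisc_of_print3 hPos hmod hGZK h17 hCassels hAU,
    fun hG => ordKatoHalfAtTwoIsoPosDisc_of_greenbergMuZero hG hAU h17⟩


/-! ## §3 SIGN-FREE NECESSITY from the crux on the whole onto habitat, Greenberg 4.1 not an input -/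

/-- **Crux 202 `OrdKatoHalfAtTwoIso` ⟹ Greenberg `μ = 0` at `2` on the WHOLE onto habitat** (non-CM, analytic rank `0`, good ordinary at `2`, `ρ̄_{W,2}`
onto; BOTH signs of `Δ`), for every normalised cyclotomic Selmer dual datum, granted {modularity, GZK, Kato 17.4 (1)(2)@2, Cassels, Abbes–Ullmo} BY NAME —
the LEAD g10's display `greenbergMu_two_onto_necessary` (skeleton v24 §4) with Greenberg 4.1 dropped (crux ⟹ half at an isogenous `W′` ⟹ §1 half at `W` ⟹
Kato 17.4 `μ`-part ⟹ `mu_eq_zero_of_katoMuPartAtTwo_of_irr`).  CONDITIONAL; nothing asserted about either side.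
[cite: GreenbergLNM1716, Conj. 1.11 (p. 64)] [cite: Kato2004Asterisque, Thm. 17.4 (1)(2) (p. 273)] [cite: AbbesUllmo1996, Thm. A] [cite: MilneADT2006, Thm. I.7.3 (Cassels)] -/
theorem greenbergMu_two_onto_habitat_of_ordKatoHalfAtTwoIso_of_print3 (hcrux : OrdKatoHalfAtTwoIso)
    (hmod : nonempty_modularParametrizationData) (hGZK : rank_eq_analyticRank_of_analyticRank_le_one)
    (h17 : ∀ (V : WeierstrassCurve ℚ) [V.IsElliptic] [V.IsGloballyMinimal] [NeZero (V.conductorNorm ℤ)]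
      (f : CuspForm (Gamma0 (V.conductorNorm ℤ)) 2), kato_divisibility_allPrimes V 2 (f := f))
    (hCassels : bsdRHS_eq_of_isIsogenous) (hAU : abbesUllmo_not_dvd_maninConstant_of_not_dvd_level) :
    ∀ (W : WeierstrassCurve ℚ) [W.IsElliptic] [W.IsGloballyMinimal],
      ¬ W.HasCM → W.analyticRank = 0 → GoodOrd W 2 → W.HasSurjectiveModNGaloisRep 2 →
      ∀ (κ : ZpExtension ℚ 2) (γ : absoluteGaloisGroup ℚ), κ.IsCyclotomic → κ.IsTopGenerator γ →
        IsCyclotomicVariable 2 γ → ∀ D : W.SelmerDualData κ γ, D.mu = 0 := by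
  intro W _ _ hcm hr hgo h2 κ γ hκ hγ hγ' D
  haveI : NeZero ((2 : ℕ) : ℚ) := ⟨by norm_num⟩
  obtain ⟨W', _, _, hiso, hK'⟩ := hcrux W hcm hr hgo
  exact mu_eq_zero_of_katoMuPartAtTwo_of_irr W hAU hmod hgo (hasIrreducibleModPGaloisRep_of_hasSurjectiveModNGaloisRep W 2 h2)
    (O1.katoMuPartAtTwo_of_mainConjectureLowerDivisibilityAtTwoOrd W (fun f ↦ h17 W f)
      (katoHalf_isogenyInvariant_of_surj hmod hGZK h17 hCassels hiso hgo h2 hr hK')) hκ hγ hγ' D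



/-! ## §4 The `Δ < 0` doors (any rank) keyed by {modularity, Kato 17.4} instead of the bundle -/

/-- **G11⁻ + {modularity, Kato 17.4 (1)@2} ⟹ `X(W/ℚ_∞)` is finitely generated over `ℤ₂`** for every curve of the `Δ < 0` cell (ANY rank) and every
normalised cyclotomic datum (w3 g7's `moduleFinite_selmerDual_of_greenbergMuNeg`, bundle-free): `X` is torsion (Kato 17.4 (1) at the conductor-level
newform), and `μ = 0 ⟺` finitely generated over `ℤ₂`.  CONDITIONAL; nothing closed.
[cite: GreenbergLNM1716, Conj. 1.11 (p. 64)] [cite: Kato2004Asterisque, Thm. 17.4 (1) (p. 273)] [cite: Washington1997, §13.2] -/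
theorem moduleFinite_selmerDual_of_greenbergMuNeg_of_print (hG : GreenbergMuZeroTwoOrdNegDisc)
    (hmod : nonempty_modularParametrizationData)
    (h17 : ∀ (V : WeierstrassCurve ℚ) [V.IsElliptic] [V.IsGloballyMinimal] [NeZero (V.conductorNorm ℤ)]
      (f : CuspForm (Gamma0 (V.conductorNorm ℤ)) 2), kato_divisibility_allPrimes V 2 (f := f))
    (W : WeierstrassCurve ℚ) [W.IsElliptic] [W.IsGloballyMinimal]
    (hgo : GoodOrd W 2) (h2 : W.HasSurjectiveModNGaloisRep 2) (hΔ : W.Δ < 0)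
    {κ : ZpExtension ℚ 2} {γ : absoluteGaloisGroup ℚ} (hκ : κ.IsCyclotomic) (hγ : κ.IsTopGenerator γ)
    (hγ' : IsCyclotomicVariable 2 γ) (D : W.SelmerDualData κ γ) :
    Module.Finite ℤ_[2] (RestrictScalars ℤ_[2] (IwasawaAlgebra 2) D.X) := by
  haveI : NeZero (W.conductorNorm ℤ) := ⟨(W.conductorNorm_pos_holds).ne'⟩
  obtain ⟨Dm⟩ := hmod W
  haveI : Module.Finite (IwasawaAlgebra 2) D.X := D.module_finite_holds hγ
  have hDt : D.IsTorsion := (h17 W Dm.f κ γ hκ hγ hγ' ⟨hgo.1, hgo.2⟩ Dm.isNewformOf D).1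
  exact (muInvariant_eq_zero_iff_holds 2 D.X hDt).mp (hG W hgo h2 hΔ κ γ hκ hγ hγ' D)

/-- **(⟸) G11⁻ + MU13⁻ ⟹ V♭⁻ VERBATIM** (the registered text of `stub_muFreeValue_negDisc_two`, skeleton v24) from the Poitou–Tate exactness fact p729889
and {modularity, Kato 17.4} — w3 g7's `muFreeValue_negDisc_of_greenbergMuNeg_of_zetaQuotientMu`, bundle-free.  CONDITIONAL; nothing closed.
[cite: Kato2004Asterisque, §17.13 (17.13.1)–(17.13.3) (pp. 279–280)] [cite: GreenbergLNM1716, Conj. 1.11 (p. 64), §4 p. 122] [cite: MilneADT2006, I Thm. 4.10] -/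
theorem muFreeValue_negDisc_of_greenbergMuNeg_of_zetaQuotientMu_of_print
    (hPT : exists_lambdaAdicLocalTatePairing_poitouTate_exact) (hmod : nonempty_modularParametrizationData)
    (h17 : ∀ (V : WeierstrassCurve ℚ) [V.IsElliptic] [V.IsGloballyMinimal] [NeZero (V.conductorNorm ℤ)]
      (f : CuspForm (Gamma0 (V.conductorNorm ℤ)) 2), kato_divisibility_allPrimes V 2 (f := f))
    (hG : GreenbergMuZeroTwoOrdNegDisc) (hZ : ZetaQuotientMuZeroTwoOrdNegDisc) :
    ∀ (W : WeierstrassCurve ℚ) [W.IsElliptic] [W.IsGloballyMinimal]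
      [ContinuousSMul ℤ_[2] (W.tateModule 2)] [Module.Free ℤ_[2] (W.tateModule 2)] [Module.Finite ℤ_[2] (W.tateModule 2)]
      {N : ℕ} [NeZero N] (f : CuspForm (Gamma0 N) 2)
      (κ : ZpExtension ℚ 2) (γ : absoluteGaloisGroup ℚ) (hκ : κ.IsCyclotomic) (hγ : κ.IsTopGenerator γ),
      W.Δ < 0 → IsOrdinaryAt W 2 → W.HasSurjectiveModNGaloisRep 2 → IsCyclotomicVariable 2 γ → IsNewformOf W f →
      ∀ (v₂ : HeightOneSpectrum (𝓞 ℚ)) (_ : ((2 : ℕ) : 𝓞 ℚ) ∈ v₂.asIdeal)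
        (γᵥ : absoluteGaloisGroup (v₂.adicCompletion ℚ))
        (hsurj : Function.Surjective
          (κ.toContinuousMonoidHom.comp (resGalOfEmb (closureEmb (K := ℚ) (v₂.adicCompletion ℚ)))))
        (hγᵥ : κ.IsTopGenerator (resGalOfEmb (closureEmb (K := ℚ) (v₂.adicCompletion ℚ)) γᵥ))
        (I : IwasawaH1Data W 2 κ γ) (J : LocalIwasawaH1Data κ v₂ ((tateRep W 2).toLocal v₂) γᵥ)
        (J' : LocalIwasawaH1Data κ v₂ (tateLocalOrdinaryRep W 2 v₂) γᵥ)
        (col : J.H →ₗ[IwasawaAlgebra 2] IwasawaAlgebra 2),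
        (∀ x : J.H, col x = 0 ↔ x ∈ LinearMap.range (J'.ordinaryInclusion J)) →
        (∃ x : J.H, col x ∉ IwasawaAlgebra.augIdealP 2) →
        ∃ g : I.H, IsEulerSystemClassTwo W hκ I g ∧ col (I.loc J hsurj hγ hγᵥ g) ∉ IwasawaAlgebra.augIdealP 2 := by
  intro W _ _ _ _ _ N _ f κ γ hκ hγ hΔ hord h2 hγ' _ v₂ hv₂ γᵥ hsurj hγᵥ I J J' col hker hnorm
  obtain ⟨D⟩ := W.nonempty_selmerDualData_holds κ γ hγ
  obtain ⟨z, hz, hzfin⟩ := hZ W κ γ hκ hγ hΔ hord h2 hγ' I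
  exact ⟨z, hz, notMem_col_loc_of_poitouTate_of_moduleFinite_quotient_span hPT W κ γ hκ hγ hord v₂ hv₂ γᵥ hsurj hγᵥ I J J' D
    (moduleFinite_selmerDual_of_greenbergMuNeg_of_print hG hmod h17 W ⟨hord.1, hord.2⟩ h2 hΔ hκ hγ hγ' D) z hzfin col
    (fun y => (hker _).mpr ⟨y, rfl⟩) hnorm⟩

/-- **F1μι⁻ = `ZetaColemanMuIotaNegDiscAtTwo` BY NAME from {hPT, hQ, modularity, Kato 17.4, G11⁻, MU13⁻}** — w3 g10's
`zetaColemanMuIotaNegDiscAtTwo_of_greenbergMuNeg_of_zetaQuotientMu_of_structureFact`, bundle-free (`hOK` fed from hPT + hQ, p746128; no `thm12_4`,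
no GZK, no Cassels, no Greenberg 4.1).  CONDITIONAL on the displayed OPEN statements; nothing closed.
[cite: GreenbergLNM1716, Conj. 1.11 (p. 64)] [cite: Kato2004Asterisque, Thm. 12.6 (p. 222), Prop. 17.11 (p. 277), §17.13 (pp. 279–280)] -/
theorem zetaColemanMuIotaNegDiscAtTwo_of_greenbergMuNeg_of_zetaQuotientMu_of_print
    (hPT : exists_lambdaAdicLocalTatePairing_poitouTate_exact) (hQ : localIwasawaH1_ordinaryQuotient_isTorsionFree_rank_eq_one)
    (hmod : nonempty_modularParametrizationData)
    (h17 : ∀ (V : WeierstrassCurve ℚ) [V.IsElliptic] [V.IsGloballyMinimal] [NeZero (V.conductorNorm ℤ)]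
      (f : CuspForm (Gamma0 (V.conductorNorm ℤ)) 2), kato_divisibility_allPrimes V 2 (f := f))
    (hG : GreenbergMuZeroTwoOrdNegDisc) (hZ : ZetaQuotientMuZeroTwoOrdNegDisc) : ZetaColemanMuIotaNegDiscAtTwo :=
  zetaColemanMuIotaNegDiscAtTwo_of_tateDuality_of_ordKernel_of_muFreeValue
    (exists_lambdaAdicLocalTatePairing_selmer_orthogonal_of_poitouTate_exact hPT)
    (exists_ordinaryKernelFunctional_of_poitouTate_of_ordinaryQuotientRank hPT hQ)
    (muFreeValue_negDisc_of_greenbergMuNeg_of_zetaQuotientMu_of_print hPT hmod h17 hG hZ)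

/-- **F1μι⁻ BY NAME from {hPT, hQ, `thm12_4`, modularity, Kato 17.4, G11⁻, N2D⁻}** (the N2D⁻ currency: `thm12_4` converts N2D⁻ into MU13⁻,
w3 g7's `zetaQuotientMu_iff_notTwoDivisible`).  CONDITIONAL; nothing closed.
[cite: GreenbergLNM1716, Conj. 1.11 (p. 64)] [cite: Kato2004Asterisque, Thm. 12.4 (2)(3) (p. 221), Thm. 12.6 (p. 222), §17.13 (pp. 279–280)] -/
theorem zetaColemanMuIotaNegDiscAtTwo_of_greenbergMuNeg_of_notTwoDivisible_of_print
    (hPT : exists_lambdaAdicLocalTatePairing_poitouTate_exact) (hQ : localIwasawaH1_ordinaryQuotient_isTorsionFree_rank_eq_one)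
    (h12 : thm12_4) (hmod : nonempty_modularParametrizationData)
    (h17 : ∀ (V : WeierstrassCurve ℚ) [V.IsElliptic] [V.IsGloballyMinimal] [NeZero (V.conductorNorm ℤ)]
      (f : CuspForm (Gamma0 (V.conductorNorm ℤ)) 2), kato_divisibility_allPrimes V 2 (f := f))
    (hG : GreenbergMuZeroTwoOrdNegDisc) (hN : ZetaNotTwoDivisibleTwoOrdNegDisc) : ZetaColemanMuIotaNegDiscAtTwo :=
  zetaColemanMuIotaNegDiscAtTwo_of_greenbergMuNeg_of_zetaQuotientMu_of_print hPT hQ hmod h17 hG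
    ((zetaQuotientMu_iff_notTwoDivisible h12).mpr hN)

/-- **NECESSITY of N2D⁻, print-light: F1μι⁻ + modularity ⟹ `ZetaNotTwoDivisibleTwoOrdNegDisc`** (w3 g8's `zetaNotTwoDivisible_of_iotaNegDisc`,
modularity conjunct only).  CONDITIONAL on the displayed OPEN F1μι⁻; nothing closed.
[cite: Kato2004Asterisque, Thm. 12.6 (p. 222), §13.1 (pp. 224–225), §17.13 (p. 280)] -/
theorem zetaNotTwoDivisible_of_iotaNegDisc_of_modularity (hmod : nonempty_modularParametrizationData)
    (hNeg : ZetaColemanMuIotaNegDiscAtTwo) : ZetaNotTwoDivisibleTwoOrdNegDisc := by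
  intro W _ _ _ _ _ κ γ hκ hγ hΔ hord h2 hγ' I
  haveI : NeZero (W.conductorNorm ℤ) := ⟨(W.conductorNorm_pos_holds).ne'⟩
  obtain ⟨Dm⟩ := hmod W
  obtain ⟨Y⟩ := W.nonempty_fineSelmerDualData κ hγ
  exact exists_esClass_not_mem_of_iotaNegDisc_at hNeg W Dm.f κ γ hκ hord h2 hΔ hγ hγ' Dm.isNewformOf
    (W.selmerDualData κ hγ) Y I

/-- **NECESSITY of G11⁻, print-light: F1μι⁻ + modularity ⟹ `GreenbergMuZeroTwoOrdNegDisc`** (w3 g8's `greenbergMuNeg_of_iotaNegDisc`, modularity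
conjunct only; engine: the LEAD's `mu_eq_zero_of_iotaNegDisc`, core Theorem A at `2` PROVED).  CONDITIONAL; nothing closed.
[cite: GreenbergLNM1716, Conj. 1.11 (p. 64)] [cite: Kato2004Asterisque, Thm. 17.4 (1) (p. 273), §17.13 (pp. 279–280)] -/
theorem greenbergMuNeg_of_iotaNegDisc_of_modularity (hmod : nonempty_modularParametrizationData)
    (hNeg : ZetaColemanMuIotaNegDiscAtTwo) : GreenbergMuZeroTwoOrdNegDisc := by
  intro W _ _ hgo h2 hΔ κ γ hκ hγ hγ' D
  haveI : NeZero (W.conductorNorm ℤ) := ⟨(W.conductorNorm_pos_holds).ne'⟩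
  obtain ⟨Dm⟩ := hmod W
  exact mu_eq_zero_of_iotaNegDisc hNeg W hgo h2 hΔ Dm.f Dm.isNewformOf κ γ hκ hγ hγ' D

/-- **F1μι⁻ ⟺ G11⁻ ∧ N2D⁻, kernel `iff` modulo {hPT, hQ, `thm12_4`, modularity, Kato 17.4 (1)(2)@2}** — w3 g10's
`iotaNegDisc_iff_greenbergMuNeg_and_notTwoDivisible_of_structureFact`, bundle-free (no GZK, no Greenberg 4.1: the `Δ < 0` conjunct never touched
either).  Neither side is proved; nothing asserted.
[cite: GreenbergLNM1716, Conj. 1.11 (p. 64)] [cite: Kato2004Asterisque, Thm. 12.4 (2)(3) (p. 221), Thm. 12.6 (p. 222), Prop. 17.11 (p. 277), §17.13 (pp. 279–280)] -/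
theorem iotaNegDisc_iff_greenbergMuNeg_and_notTwoDivisible_of_print3
    (hPT : exists_lambdaAdicLocalTatePairing_poitouTate_exact) (hQ : localIwasawaH1_ordinaryQuotient_isTorsionFree_rank_eq_one)
    (h12 : thm12_4) (hmod : nonempty_modularParametrizationData)
    (h17 : ∀ (V : WeierstrassCurve ℚ) [V.IsElliptic] [V.IsGloballyMinimal] [NeZero (V.conductorNorm ℤ)]
      (f : CuspForm (Gamma0 (V.conductorNorm ℤ)) 2), kato_divisibility_allPrimes V 2 (f := f)) :
    ZetaColemanMuIotaNegDiscAtTwo ↔ (GreenbergMuZeroTwoOrdNegDisc ∧ ZetaNotTwoDivisibleTwoOrdNegDisc) :=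
  ⟨fun hNeg => ⟨greenbergMuNeg_of_iotaNegDisc_of_modularity hmod hNeg, zetaNotTwoDivisible_of_iotaNegDisc_of_modularity hmod hNeg⟩,
    fun h => zetaColemanMuIotaNegDiscAtTwo_of_greenbergMuNeg_of_notTwoDivisible_of_print hPT hQ h12 hmod h17 h.1 h.2⟩


/-! ## §5 The whole child 24097, keyed by {hPT, hQ, thm12_4, modularity, GZK, Kato 17.4@2, Cassels, Abbes–Ullmo} — Greenberg 4.1 gone -/

/-- **The PAIR child `OrdKatoFineZetaAtTwoResidue` (stmt-BirchSwinnertonDyer-24097) ⟺ G11⁺ ∧ G11⁻ ∧ N2D⁻, kernel `iff` modulo print BY NAME with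
GREENBERG'S THEOREM 4.1 OFF THE BINDER LIST** — w3 g10's `…_iff_greenbergMu_both_and_notTwoDivisible_of_structureFact` re-keyed from {hPT, hQ, `thm12_4`,
`OrdPublishedInputsAtTwo`, Cassels, AU} to {hPT (p729889), hQ (p740652), `thm12_4`, modularity, GZK, Kato 17.4 (1)(2)@2, Cassels, AU}: halves
(`ordKatoFineZetaAtTwoResidue_iff_halves`), F1μι⁻ ⟺ G11⁻ ∧ N2D⁻ (§4), `0 < Δ` conjunct ⟺ G11⁺ (§2, the only place GZK and Cassels enter).  The right-hand side
is Greenberg's Conjecture 1.11 at `2` on both onto cells + the `2`-indivisibility of Kato's Euler system on `Δ < 0`.  Neither side is proved; nothing asserted.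
[cite: GreenbergLNM1716, Conj. 1.11 (p. 64)] [cite: Kato2004Asterisque, Thm. 12.4 (2)(3) (p. 221), Thm. 12.6 (p. 222), Thm. 17.4 (1)(2) (p. 273), Prop. 17.11 (p. 277), §17.13 (pp. 279–280)]
[cite: AbbesUllmo1996, Thm. A] [cite: MilneADT2006, I Thm. 4.10 and Thm. I.7.3 (Cassels)] -/
theorem ordKatoFineZetaAtTwoResidue_iff_greenbergMu_both_and_notTwoDivisible_of_print3
    (hPT : exists_lambdaAdicLocalTatePairing_poitouTate_exact) (hQ : localIwasawaH1_ordinaryQuotient_isTorsionFree_rank_eq_one)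
    (h12 : thm12_4) (hmod : nonempty_modularParametrizationData) (hGZK : rank_eq_analyticRank_of_analyticRank_le_one)
    (h17 : ∀ (V : WeierstrassCurve ℚ) [V.IsElliptic] [V.IsGloballyMinimal] [NeZero (V.conductorNorm ℤ)]
      (f : CuspForm (Gamma0 (V.conductorNorm ℤ)) 2), kato_divisibility_allPrimes V 2 (f := f))
    (hCassels : bsdRHS_eq_of_isIsogenous) (hAU : abbesUllmo_not_dvd_maninConstant_of_not_dvd_level) :
    OrdKatoFineZetaAtTwoResidue ↔
      (GreenbergMuZeroTwoOrdPosDisc ∧ GreenbergMuZeroTwoOrdNegDisc ∧ ZetaNotTwoDivisibleTwoOrdNegDisc) := by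
  rw [ordKatoFineZetaAtTwoResidue_iff_halves, iotaNegDisc_iff_greenbergMuNeg_and_notTwoDivisible_of_print3 hPT hQ h12 hmod h17,
    posDisc_iff_greenbergMu_of_print3 hmod hGZK h17 hCassels hAU]
  exact ⟨fun h => ⟨h.2, h.1.1, h.1.2⟩, fun h => ⟨⟨h.2.1, h.2.2⟩, h.1⟩⟩


/-- **The child from the three displayed statements BY NAME (N2D⁻ currency), keyed by {hPT, hQ, `thm12_4`, modularity, Kato 17.4@2, Abbes–Ullmo}** —
the (⟸) half for the skeleton: G11⁺, G11⁻, N2D⁻ + print ⟹ 24097; GZK, Cassels and Greenberg 4.1 are NOT inputs of this direction.  CONDITIONAL on the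
displayed OPEN statements; the item is NOT closed by this.
[cite: GreenbergLNM1716, Conj. 1.11 (p. 64)] [cite: Kato2004Asterisque, Thm. 12.4 (2)(3) (p. 221), Thm. 17.4 (1)(2) (p. 273), §17.13 (pp. 279–280)] [cite: AbbesUllmo1996, Thm. A] -/
theorem ordKatoFineZetaAtTwoResidue_of_greenbergMu_both_of_notTwoDivisible_of_print3
    (hPT : exists_lambdaAdicLocalTatePairing_poitouTate_exact) (hQ : localIwasawaH1_ordinaryQuotient_isTorsionFree_rank_eq_one)
    (h12 : thm12_4) (hmod : nonempty_modularParametrizationData)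
    (h17 : ∀ (V : WeierstrassCurve ℚ) [V.IsElliptic] [V.IsGloballyMinimal] [NeZero (V.conductorNorm ℤ)]
      (f : CuspForm (Gamma0 (V.conductorNorm ℤ)) 2), kato_divisibility_allPrimes V 2 (f := f))
    (hAU : abbesUllmo_not_dvd_maninConstant_of_not_dvd_level)
    (hGp : GreenbergMuZeroTwoOrdPosDisc) (hG : GreenbergMuZeroTwoOrdNegDisc) (hN : ZetaNotTwoDivisibleTwoOrdNegDisc) :
    OrdKatoFineZetaAtTwoResidue :=
  ordKatoFineZetaAtTwoResidue_of_halves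
    (zetaColemanMuIotaNegDiscAtTwo_of_greenbergMuNeg_of_notTwoDivisible_of_print hPT hQ h12 hmod h17 hG hN)
    (ordKatoHalfAtTwoIsoPosDisc_of_greenbergMuZero hGp hAU h17)

/-- **The child BY NAME in the MU13⁻ currency, keyed by {hPT, hQ, modularity, Kato 17.4@2, Abbes–Ullmo} — `thm12_4`-free, GZK-free, Cassels-free,
Greenberg-4.1-free**: G11⁺, G11⁻, MU13⁻ + these five print facts ⟹ 24097 (MU13⁻ carries weak Leopoldt at `2` off the habitat, w3 g9 §2 — the pricing word
stands).  CONDITIONAL on the displayed OPEN statements; the item is NOT closed by this.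
[cite: GreenbergLNM1716, Conj. 1.11 (p. 64)] [cite: Kato2004Asterisque, Thm. 12.6 (p. 222), Thm. 17.4 (1)(2) (p. 273), Prop. 17.11 (p. 277), §17.13 (pp. 279–280)] [cite: AbbesUllmo1996, Thm. A] -/
theorem ordKatoFineZetaAtTwoResidue_of_greenbergMu_both_of_zetaQuotientMu_of_print
    (hPT : exists_lambdaAdicLocalTatePairing_poitouTate_exact) (hQ : localIwasawaH1_ordinaryQuotient_isTorsionFree_rank_eq_one)
    (hmod : nonempty_modularParametrizationData)
    (h17 : ∀ (V : WeierstrassCurve ℚ) [V.IsElliptic] [V.IsGloballyMinimal] [NeZero (V.conductorNorm ℤ)]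
      (f : CuspForm (Gamma0 (V.conductorNorm ℤ)) 2), kato_divisibility_allPrimes V 2 (f := f))
    (hAU : abbesUllmo_not_dvd_maninConstant_of_not_dvd_level)
    (hGp : GreenbergMuZeroTwoOrdPosDisc) (hG : GreenbergMuZeroTwoOrdNegDisc) (hZ : ZetaQuotientMuZeroTwoOrdNegDisc) :
    OrdKatoFineZetaAtTwoResidue :=
  ordKatoFineZetaAtTwoResidue_of_halves
    (zetaColemanMuIotaNegDiscAtTwo_of_greenbergMuNeg_of_zetaQuotientMu_of_print hPT hQ hmod h17 hG hZ)
    (ordKatoHalfAtTwoIsoPosDisc_of_greenbergMuZero hGp hAU h17)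

/-- **NECESSITY of the whole right-hand side from the child, keyed by {modularity, GZK, Kato 17.4@2, Cassels, AU}** (no hPT, no hQ, no `thm12_4`,
no Greenberg 4.1): child 24097 ⟹ G11⁺ ∧ G11⁻ ∧ N2D⁻.  CONDITIONAL; nothing closed.
[cite: GreenbergLNM1716, Conj. 1.11 (p. 64)] [cite: Kato2004Asterisque, Thm. 12.6 (p. 222), Thm. 17.4 (1)(2) (p. 273), §17.13 (p. 280)] [cite: AbbesUllmo1996, Thm. A]
[cite: MilneADT2006, Thm. I.7.3 (Cassels)] -/
theorem greenbergMu_both_and_notTwoDivisible_of_ordKatoFineZetaAtTwoResidue_of_print3 (hchild : OrdKatoFineZetaAtTwoResidue)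
    (hmod : nonempty_modularParametrizationData) (hGZK : rank_eq_analyticRank_of_analyticRank_le_one)
    (h17 : ∀ (V : WeierstrassCurve ℚ) [V.IsElliptic] [V.IsGloballyMinimal] [NeZero (V.conductorNorm ℤ)]
      (f : CuspForm (Gamma0 (V.conductorNorm ℤ)) 2), kato_divisibility_allPrimes V 2 (f := f))
    (hCassels : bsdRHS_eq_of_isIsogenous) (hAU : abbesUllmo_not_dvd_maninConstant_of_not_dvd_level) :
    GreenbergMuZeroTwoOrdPosDisc ∧ GreenbergMuZeroTwoOrdNegDisc ∧ ZetaNotTwoDivisibleTwoOrdNegDisc := by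
  obtain ⟨hNeg, hPos⟩ := ordKatoFineZetaAtTwoResidue_iff_halves.mp hchild
  exact ⟨greenbergMuZeroTwoOrdPosDisc_of_posDisc_of_print3 hPos hmod hGZK h17 hCassels hAU,
    greenbergMuNeg_of_iotaNegDisc_of_modularity hmod hNeg, zetaNotTwoDivisible_of_iotaNegDisc_of_modularity hmod hNeg⟩

end Summit.BirchSwinnertonDyer.BirchSwinnertonDyer.Theorems.SteinbergFibreAtTwo

end
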